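import Summits.Ventures.PercRepro.RankDistTightPos
import Summits.Ventures.PercRepro.RankLevelSetBiIndepPerElem

/-!
# PercRepro — THE INDEPENDENT SHADOW OF THE TIGHT LAYER IS THE BI-INDEPENDENT PROFILE: the bridge between the
`RankDistTight*` modules (p9) and the `RankLevelSetBiIndep*` modules (night-1), the monotone form of the profile
⟹ the cumulative inequality of the independent shadow, and the CLOSED-BOTTOM case of the dependent shadow
(p9, gen 20)

On the tight layer (`|E| = p + q`, `ρ(E) = p`) the independent shadow sets of rank `u` (`indepShadow M p q u`,
RankDistTightSymm) are exactly the bi-independent `u`-sets `biIndep M u` of RankLevelSetBiIndepProfile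
(`coe_indepShadow_eq_biIndep`), so `i_u = D_u` (`card_indepShadow_eq_biIndepCount`). Hence the MONOTONE FORM
`BiIndepMono M` of night-1's per-element line gives the cumulative inequality of the independent shadow,
`IndepShadowCumulative M p q` (`indepShadowCumulative_of_biIndepMono`, from `biIndepNorm_ge_of_mono`), and the
row C-048 on the tight layer reduces to `BiIndepMono M` plus its DEPENDENT part
(`shadowCumulative_of_biIndepMono`). The dependent part at level `q` is empty exactly when every bottom set is
closed (`depShadow_q_eq_empty_iff_closed`): a rank-`q` shadow set lies between a bottom set and its closure. In
particular every matroid of the tight layer whose circuits all have at least `q + 2` elements has closed bottom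
sets (`closure_Uq_eq_self_of_circuits`), its dependent part satisfies the cumulative inequality trivially
(`depShadowCumulative_of_closed`), and C-048 — hence C-025 — holds there under `BiIndepMono M`
(`shadowCumulative_of_biIndepMono_of_circuits`, `rls_of_biIndepMono_of_circuits`). Nothing here moves any window
of the crux; the statements are bridges between two lanes of the cell, in the tree's vocabulary.
-/

namespace PercRepro.RankDist

open Set Finset _root_.Matroid PercRepro.ThmH

variable {α : Type} [DecidableEq α] (M : Matroid α) [M.Finite]

/-! ## The independent shadow is the bi-independent profile -/

/-- **On the tight layer the independent shadow sets of rank `u` are the bi-independent `u`-sets.** -/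
theorem coe_indepShadow_eq_biIndep {p q : ℕ} (hn : (gr M).card = p + q) (hr : M.eRank = (p : ℕ∞)) (u : ℕ) :
    ((indepShadow M p q u : Finset (Set α)) : Set (Set α)) = biIndep M u := by
  ext A
  rw [Finset.mem_coe, mem_indepShadow_iff_tight M hn hr]
  simp only [biIndep, Set.mem_setOf_eq]

/-- **`i_u = D_u` on the tight layer.** -/
theorem card_indepShadow_eq_biIndepCount {p q : ℕ} (hn : (gr M).card = p + q) (hr : M.eRank = (p : ℕ∞))
    (u : ℕ) : (indepShadow M p q u).card = biIndepCount M u := by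
  rw [biIndepCount, ← coe_indepShadow_eq_biIndep M hn hr u, Set.ncard_coe_finset]

/-- **The monotone form of the bi-independent profile gives the cumulative inequality of the independent
shadow** (tight layer): `BiIndepMono M` ⟹ `i_q·C(p+q, u) ≤ i_u·C(p+q, q)` for every `q < u < p`. -/
theorem indepShadowCumulative_of_biIndepMono {p q : ℕ} (hn : (gr M).card = p + q) (hr : M.eRank = (p : ℕ∞))
    (hmono : BiIndepMono M) : IndepShadowCumulative M p q := by
  intro u hqu hup
  have hE : M.E.ncard = p + q := by rw [← card_gr M]; exact hn
  have h := biIndepNorm_ge_of_mono M hmono (q := q) (t := u) hqu.le (by omega)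
  rw [card_indepShadow_eq_biIndepCount M hn hr, card_indepShadow_eq_biIndepCount M hn hr]
  unfold biIndepNorm at h
  rw [hE] at h
  have hq : (0 : ℚ) < ((p + q).choose q : ℚ) := by exact_mod_cast Nat.choose_pos (by omega)
  have hu : (0 : ℚ) < ((p + q).choose u : ℚ) := by exact_mod_cast Nat.choose_pos (by omega)
  rw [div_le_div_iff₀ hq hu] at h
  exact_mod_cast h

/-- **C-048 on the tight layer from the monotone form of the profile and its dependent part.** -/
theorem shadowCumulative_of_biIndepMono {p q : ℕ} (hn : (gr M).card = p + q) (hr : M.eRank = (p : ℕ∞))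
    (hmono : BiIndepMono M) (hd : DepShadowCumulative M p q) : ShadowCumulative M p q :=
  shadowCumulative_of_split M (indepShadowCumulative_of_biIndepMono M hn hr hmono) hd

/-! ## The dependent shadow at level `q`: the sets between a bottom set and its closure -/

open scoped Classical in
/-- Membership in `depShadow`. -/
lemma mem_depShadow {p q u : ℕ} {A : Set α} :
    A ∈ depShadow M p q u ↔ A ∈ shadowLev M u (PerFlat.Uq M p q) ∧ ¬ M.Indep A := by
  unfold depShadow
  rw [Finset.mem_filter]

/-- A rank-`q` shadow set lies in the closure of every bottom set it contains (tight layer). -/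
lemma subset_closure_of_mem_shadowLev_q {p q : ℕ} (hn : (gr M).card = p + q) (hr : M.eRank = (p : ℕ∞))
    {A : Set α} (hA : A ∈ shadowLev M q (PerFlat.Uq M p q)) {B : Finset α} (hB : B ∈ PerFlat.Uq M p q)
    (hBA : (B : Set α) ⊆ A) : A ⊆ M.closure (B : Set α) := by
  obtain ⟨hAE, hAq, -⟩ := (mem_shadowLev M).1 hA
  obtain ⟨-, hBind, hBq, -⟩ := (mem_Uq_tight M hn hr).1 hB
  have hfin : M.IsRkFinite (B : Set α) := RankFinite.isRkFinite _
  have hle : M.eRk A ≤ M.eRk (B : Set α) := by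
    rw [eRk_eq_coe_rk M hAE, hAq, hBind.eRk_eq_encard, Set.encard_coe_eq_coe_finsetCard, hBq]
  rw [hfin.closure_eq_closure_of_subset_of_eRk_ge_eRk hBA hle]
  exact M.subset_closure A hAE

/-- **If every bottom set is closed, the dependent shadow at level `q` is empty**: a rank-`q` shadow set `A ⊇ B`
satisfies `A ⊆ cl(B) = B`, so `A = B` is independent. -/
theorem depShadow_q_eq_empty_of_closed {p q : ℕ} (hn : (gr M).card = p + q) (hr : M.eRank = (p : ℕ∞))
    (hcl : ∀ B ∈ PerFlat.Uq M p q, M.closure (B : Set α) = B) : depShadow M p q q = ∅ := by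
  rw [Finset.eq_empty_iff_forall_notMem]
  intro A hA
  obtain ⟨hA, hdep⟩ := (mem_depShadow M).1 hA
  obtain ⟨-, -, B, hB, hBA⟩ := (mem_shadowLev M).1 hA
  have hsub := subset_closure_of_mem_shadowLev_q M hn hr hA hB hBA
  rw [hcl B hB] at hsub
  apply hdep
  rw [Set.Subset.antisymm hsub hBA]
  exact ((mem_Uq_tight M hn hr).1 hB).2.1

/-- **If a bottom set is not closed, the dependent shadow at level `q` is non-empty**: for `x ∈ cl(B) ∖ B` the
set `B ∪ {x}` is a dependent shadow set of rank `q`. -/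
theorem insert_mem_depShadow_q {p q : ℕ} (hn : (gr M).card = p + q) (hr : M.eRank = (p : ℕ∞))
    {B : Finset α} (hB : B ∈ PerFlat.Uq M p q) {x : α} (hx : x ∈ M.closure (B : Set α) \ B) :
    insert x (B : Set α) ∈ depShadow M p q q := by
  obtain ⟨-, hBind, hBq, -⟩ := (mem_Uq_tight M hn hr).1 hB
  have hxE : x ∈ M.E := M.closure_subset_ground _ hx.1
  have hsubE : insert x (B : Set α) ⊆ M.E := Set.insert_subset hxE hBind.subset_ground
  have hdep : M.Dep (insert x (B : Set α)) := hBind.insert_dep_iff.2 hx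
  rw [mem_depShadow, mem_shadowLev]
  refine ⟨⟨hsubE, ?_, B, hB, Set.subset_insert _ _⟩, hdep.not_indep⟩
  -- the rank of `B ∪ {x}` is the rank of `B`, namely `q`
  have h1 : M.eRk (insert x (B : Set α)) ≤ M.eRk (B : Set α) := by
    calc M.eRk (insert x (B : Set α)) ≤ M.eRk (M.closure (B : Set α)) :=
          M.eRk_mono (Set.insert_subset hx.1 (M.subset_closure _ hBind.subset_ground))
      _ = M.eRk (B : Set α) := M.eRk_closure_eq _
  have h2 : M.eRk (B : Set α) ≤ M.eRk (insert x (B : Set α)) := M.eRk_mono (Set.subset_insert _ _)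
  have h3 : M.eRk (insert x (B : Set α)) = (q : ℕ∞) := by
    rw [le_antisymm h1 h2, hBind.eRk_eq_encard, Set.encard_coe_eq_coe_finsetCard, hBq]
  rw [eRk_eq_coe_rk M hsubE] at h3
  exact_mod_cast h3

/-- **The dependent shadow at level `q` is empty iff every bottom set is closed** (tight layer). -/
theorem depShadow_q_eq_empty_iff_closed {p q : ℕ} (hn : (gr M).card = p + q) (hr : M.eRank = (p : ℕ∞)) :
    depShadow M p q q = ∅ ↔ ∀ B ∈ PerFlat.Uq M p q, M.closure (B : Set α) = B := by
  refine ⟨fun h B hB => ?_, depShadow_q_eq_empty_of_closed M hn hr⟩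
  by_contra hne
  have hBind := ((mem_Uq_tight M hn hr).1 hB).2.1
  have hsub : (B : Set α) ⊆ M.closure (B : Set α) := M.subset_closure _ hBind.subset_ground
  obtain ⟨x, hx⟩ : (M.closure (B : Set α) \ B).Nonempty :=
    Set.sdiff_nonempty.2 fun h => hne (Set.Subset.antisymm h hsub)
  have hmem := insert_mem_depShadow_q M hn hr hB hx
  rw [h] at hmem
  exact Finset.notMem_empty _ hmem

/-- **With closed bottom sets the dependent shadow satisfies the cumulative inequality trivially** (`d_q = 0`). -/
theorem depShadowCumulative_of_closed {p q : ℕ} (hn : (gr M).card = p + q) (hr : M.eRank = (p : ℕ∞))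
    (hcl : ∀ B ∈ PerFlat.Uq M p q, M.closure (B : Set α) = B) : DepShadowCumulative M p q := by
  intro u _ _
  rw [depShadow_q_eq_empty_of_closed M hn hr hcl, Finset.card_empty, zero_mul]
  exact Nat.zero_le _

/-! ## Circuits of at least `q + 2` elements -/

/-- **If every circuit has at least `q + 2` elements, every bottom set of the tight layer is closed**: an element
`x ∈ cl(B) ∖ B` would put a circuit of at most `q + 1` elements inside `B ∪ {x}`. -/
theorem closure_Uq_eq_self_of_circuits {p q : ℕ} (hn : (gr M).card = p + q) (hr : M.eRank = (p : ℕ∞))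
    (hg : ∀ C, M.IsCircuit C → ((q + 2 : ℕ) : ℕ∞) ≤ C.encard) :
    ∀ B ∈ PerFlat.Uq M p q, M.closure (B : Set α) = B := by
  intro B hB
  obtain ⟨-, hBind, hBq, -⟩ := (mem_Uq_tight M hn hr).1 hB
  refine Set.Subset.antisymm (fun x hx => ?_) (M.subset_closure _ hBind.subset_ground)
  by_contra hxB
  have hdep : M.Dep (insert x (B : Set α)) := hBind.insert_dep_iff.2 ⟨hx, hxB⟩
  obtain ⟨C, hCsub, hC⟩ := hdep.exists_isCircuit_subset
  have h1 : C.encard ≤ (insert x (B : Set α)).encard := Set.encard_le_encard hCsub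
  rw [Set.encard_insert_of_notMem hxB, Set.encard_coe_eq_coe_finsetCard, hBq] at h1
  have h2 : ((q + 2 : ℕ) : ℕ∞) ≤ ((q + 1 : ℕ) : ℕ∞) := by
    refine (hg C hC).trans (h1.trans ?_)
    push_cast
    exact le_rfl
  have h3 : q + 2 ≤ q + 1 := by exact_mod_cast h2
  omega

/-- **C-048 on the tight layer for matroids whose circuits have at least `q + 2` elements, from the monotone
form of the bi-independent profile.** -/
theorem shadowCumulative_of_biIndepMono_of_circuits {p q : ℕ} (hn : (gr M).card = p + q)
    (hr : M.eRank = (p : ℕ∞)) (hmono : BiIndepMono M)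
    (hg : ∀ C, M.IsCircuit C → ((q + 2 : ℕ) : ℕ∞) ≤ C.encard) : ShadowCumulative M p q :=
  shadowCumulative_of_biIndepMono M hn hr hmono
    (depShadowCumulative_of_closed M hn hr (closure_Uq_eq_self_of_circuits M hn hr hg))

/-- **C-025 on the tight layer for matroids whose circuits have at least `q + 2` elements, from the monotone
form of the bi-independent profile.** -/
theorem rls_of_biIndepMono_of_circuits {p q : ℕ} (hn : (gr M).card = p + q) (hr : M.eRank = (p : ℕ∞))
    (hmono : BiIndepMono M) (hg : ∀ C, M.IsCircuit C → ((q + 2 : ℕ) : ℕ∞) ≤ C.encard) : ThmN.RLS M p q :=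
  rls_of_shadowCumulative M p q (shadowCumulative_of_biIndepMono_of_circuits M hn hr hmono hg)

/-- The same from night-1's per-element inequality (★★). -/
theorem shadowCumulative_of_biIndepPerElem_of_circuits {p q : ℕ} (hn : (gr M).card = p + q)
    (hr : M.eRank = (p : ℕ∞)) (hpe : BiIndepPerElem M)
    (hg : ∀ C, M.IsCircuit C → ((q + 2 : ℕ) : ℕ∞) ≤ C.encard) : ShadowCumulative M p q :=
  shadowCumulative_of_biIndepMono_of_circuits M hn hr (biIndepMono_of_perElem M hpe) hg

end PercRepro.RankDist
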